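import Literature.Geometry.Kaehler.OsculatingUnitaryFrameSqrtProofs
import Literature.Geometry.Kaehler.KaehlerChartMetricProofs
import Literature.NumberTheory.Transcendental.KaehlerLefschetzOperatorProofs
import Literature.Analysis.Complex.PQTypesPullbackProofs
import Mathlib.Geometry.Manifold.BumpFunction

/-!
# Osculating test forms on a Kähler manifold: definition, chart expression, smoothness, `dΘ(x₀) = 0`

The test forms of Voisin's osculation argument for the Kähler identities (Voisin (2002),
Prop. 6.5 via Prop. 3.14), on a complex manifold `M` with a smooth Hermitian metric written as a
family `G : M → E →L[ℝ] E →L[ℝ] ℝ` (`G x v w = ⟪v, w⟫ₓ`). Fix `x₀`, the chart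
`e = extChartAt 𝓘(ℝ, E) x₀` with centre `c = e x₀`, the coordinate metric `Ĝ`
(`KaehlerChartMetricProofs.lean`), a Riesz map `S` of `g₀ = G x₀ = Ĝ c`, a Koszul map `B` and the
osculating unitary frame `M_f y = √(Q y) ∘ A y` of `OsculatingUnitaryFrame(Sqrt)Proofs.lean`. For a
form `η` on the model space (= on `T_{x₀} M`) and a real function `f` on `M` (a bump at `x₀`) the
**test form** is

  `Θ_{f,η} (y') = f y' • η ∘ (M_f (e y') ∘ De_{y'})^{⊗k}`,  `De_{y'} = mfderiv e y'`.

* `testForm_inChart`: in the chart at `x₀`, `Θ_{f,η}` reads `y ↦ f (e⁻¹ y) • η ∘ (M_f y)^{⊗k}`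
  (`De ∘ D(e⁻¹) = 1`);
* `isSmoothForm_testForm`: `Θ_{f,η}` is a smooth form when `f` is a smooth bump function at `x₀` on
  whose closed support `M_f` is `C^∞` (`eventually_contDiffAt_frameM`);
* `testForm_typeComponent`: the `(p,q)`-components of `Θ_{f,η}` are the test forms of the
  `(p,q)`-components of `η`, wherever `M_f (e y')` is `ℂ`-linear (`eventually_frameM_comm`);
* **`mextDeriv_testForm_eq_zero`**: `dΘ_{f,η}(x₀) = 0` when `f = 1` near `x₀` — in the chart,
  `d(η ∘ M_f^{⊗k})(c)` is the alternatization of `η(…, DM_f(c) u v, …)` and `DM_f(c) u v = B u v` is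
  symmetric (`hasFDerivAt_frameM`, `koszul_symm'`,
  Mathlib's `alternatizeUncurryFin_fderivCompContinuousLinearMap_eq_zero`).

The interaction with `L`, `⋆` and `∂`, `∂̄*` is in the sequel. No definitions (local notations only).

## References

* C. Voisin, *Hodge Theory and Complex Algebraic Geometry I* (2002), Prop. 3.14, §6.1.1 Prop. 6.5.
  [Voisin2002]
-/

noncomputable section

open scoped Manifold ContDiff Topology RealInnerProductSpace
open Set Function Bundle Module Filter ContinuousAlternatingMap
open Literature.Analysis.OperatorTheory Literature.Analysis.Complex
open Literature.NumberTheory.Transcendental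

namespace Literature.Geometry.Kaehler

set_option quotPrecheck false

section TestForms

variable {E : Type*} [NormedAddCommGroup E] [NormedSpace ℂ E] [CompleteSpace E]
  {M : Type*} [TopologicalSpace M] [ChartedSpace E M] [IsManifold 𝓘(ℝ, E) ∞ M]
  (G : M → E →L[ℝ] E →L[ℝ] ℝ) (S : (E →L[ℝ] ℝ) →L[ℝ] E) (B : E →L[ℝ] E →L[ℝ] E) (x₀ : M)
  {k : ℕ}

set_option hygiene false in
/-- The chart at `x₀`. -/
local notation "e₀" => extChartAt 𝓘(ℝ, E) x₀

set_option hygiene false in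
/-- Its centre. -/
local notation "c₀" => extChartAt 𝓘(ℝ, E) x₀ x₀

set_option hygiene false in
/-- The derivative of the inverse chart at `y`. -/
local notation "Sc[" y "]" => tangentCoordChange 𝓘(ℝ, E) x₀
  ((extChartAt 𝓘(ℝ, E) x₀).symm y) ((extChartAt 𝓘(ℝ, E) x₀).symm y)

set_option hygiene false in
/-- The coordinate metric. -/
local notation "Ĝ[" y "]" => ContinuousLinearMap.bilinearComp
  (G ((extChartAt 𝓘(ℝ, E) x₀).symm y)) (Sc[y]) (Sc[y])

set_option hygiene false in
/-- `A y = 1 + B (y - c)`. -/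
local notation "A[" y "]" => ((1 : E →L[ℝ] E) + B (y - c₀))

set_option hygiene false in
/-- `A y⁻¹`. -/
local notation "Ai[" y "]" => Ring.inverse ((1 : E →L[ℝ] E) + B (y - c₀))

set_option hygiene false in
/-- The Gram operator of the transported metric. -/
local notation "Q[" y "]" => ContinuousLinearMap.comp S
  (ContinuousLinearMap.bilinearComp (Ĝ[y]) (Ai[y]) (Ai[y]))

set_option hygiene false in
/-- The square root near `1`. -/
local notation "√₁" => HasStrictFDerivAt.localInverse (fun X : E →L[ℝ] E ↦ X * X)
  (ContinuousLinearEquiv.smulLeft (Units.mk0 (2 : ℝ) two_ne_zero) : (E →L[ℝ] E) ≃L[ℝ] (E →L[ℝ] E))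
  1 hasStrictFDerivAt_mul_self_one

set_option hygiene false in
/-- The osculating unitary frame `M_f y = √(Q y) ∘ A y`. -/
local notation "Mf[" y "]" => (√₁ (Q[y]) * A[y])

set_option hygiene false in
/-- The frame map on the manifold: `U_{y'} = M_f (e y') ∘ De_{y'} : T_{y'} M → E`. -/
local notation "U[" y' "]" => ContinuousLinearMap.comp (Mf[extChartAt 𝓘(ℝ, E) x₀ y'])
  (mfderiv 𝓘(ℝ, E) 𝓘(ℝ, E) (extChartAt 𝓘(ℝ, E) x₀) y')

set_option hygiene false in
/-- The test form `Θ_{f,η} (y') = f y' • η ∘ U_{y'}^{⊗k}`. -/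
local notation "Θ[" f ", " η "]" =>
  (fun y' : M ↦ (f y' : ℝ) • ContinuousAlternatingMap.compContinuousLinearMap η (U[y']))

/-! #### Chart facts -/

omit [CompleteSpace E] in
/-- `De_{e⁻¹ y} ∘ D(e⁻¹)_y = 1` applied: for `y` in the chart target. [folklore] -/
theorem chartDeriv_apply_symmDeriv {y : E} (hy : y ∈ (e₀).target) (w : E) :
    mfderiv 𝓘(ℝ, E) 𝓘(ℝ, E) (e₀) ((e₀).symm y)
      (mfderivWithin 𝓘(ℝ, E) 𝓘(ℝ, E) (e₀).symm (range 𝓘(ℝ, E)) y w) = w := by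
  exact congrArg (fun T : TangentSpace 𝓘(ℝ, E) y →L[ℝ] TangentSpace 𝓘(ℝ, E) y ↦ T w)
    (mfderiv_extChartAt_comp_mfderivWithin_extChartAt_symm (I := 𝓘(ℝ, E)) hy)

omit [CompleteSpace E] in
/-- `D(e⁻¹)_{e y'} ∘ De_{y'} = 1` applied, through `Sc`: `Sc[e y'] (De_{y'} v) = v` for `y'` in the
chart source. [folklore] -/
theorem symmDeriv_apply_chartDeriv {y' : M} (hy' : y' ∈ (e₀).source) (v : TangentSpace 𝓘(ℝ, E) y') :
    Sc[e₀ y'] (mfderiv 𝓘(ℝ, E) 𝓘(ℝ, E) (e₀) y' v) = v := by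
  have hy : e₀ y' ∈ (e₀).target := (e₀).map_source hy'
  rw [← mfderivWithin_extChartAt_symm_eq_tangentCoordChange hy]
  exact congrArg (fun T : TangentSpace 𝓘(ℝ, E) y' →L[ℝ] TangentSpace 𝓘(ℝ, E) y' ↦ T v)
    (mfderivWithin_extChartAt_symm_comp_mfderiv_extChartAt' (I := 𝓘(ℝ, E)) hy')

omit [CompleteSpace E] in
/-- **The chart derivative is `ℂ`-linear** (holomorphic atlas): `De_{y'} (i v) = i De_{y'} v`.
[cite: Voisin2002, §2.2.1] -/
theorem chartDeriv_I_smul [IsManifold 𝓘(ℂ, E) ω M] {y' : M} (hy' : y' ∈ (e₀).source)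
    (v : TangentSpace 𝓘(ℝ, E) y') :
    mfderiv 𝓘(ℝ, E) 𝓘(ℝ, E) (e₀) y' (HSMul.hSMul (β := E) (γ := E) Complex.I v) =
      HSMul.hSMul (β := E) (γ := E) Complex.I (mfderiv 𝓘(ℝ, E) 𝓘(ℝ, E) (e₀) y' v) := by
  have hy'c : y' ∈ (chartAt E x₀).source := by rwa [extChartAt_source] at hy'
  rw [← TangentBundle.continuousLinearMapAt_trivializationAt hy'c,
    TangentBundle.continuousLinearMapAt_trivializationAt_eq_core hy'c]
  have hz : y' ∈ (extChartAt 𝓘(ℂ, E) y').source ∩ (extChartAt 𝓘(ℂ, E) x₀).source := by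
    refine ⟨mem_extChartAt_source y', ?_⟩
    rwa [extChartAt_source] at hy' ⊢
  have key := tangentCoordChange_eq_restrictScalars (E := E) (M := M) hz
  rw [tangentCoordChange] at key
  rw [key]
  exact (tangentCoordChange 𝓘(ℂ, E) y' x₀ y').map_smul Complex.I v

/-! #### The chart expression of the test forms -/

/-- Composition of pull-backs: `(η ∘ A^{⊗}) ∘ C^{⊗} = η ∘ (A ∘ C)^{⊗}`. [folklore] -/
theorem compContinuousLinearMap_compContinuousLinearMap {V₁ V₂ V₃ : Type*}
    [NormedAddCommGroup V₁] [NormedSpace ℝ V₁] [NormedAddCommGroup V₂] [NormedSpace ℝ V₂]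
    [NormedAddCommGroup V₃] [NormedSpace ℝ V₃]
    (η : V₃ [⋀^Fin k]→L[ℝ] ℂ) (A' : V₂ →L[ℝ] V₃) (C : V₁ →L[ℝ] V₂) :
    (η.compContinuousLinearMap A').compContinuousLinearMap C =
      η.compContinuousLinearMap (A'.comp C) := by
  ext v
  simp only [compContinuousLinearMap_apply, ContinuousLinearMap.coe_comp]
  rfl

/-- **The test form in the chart at `x₀`**: for `y` in the chart target,
`Θ_{f,η}.inChart x₀ y = f (e⁻¹ y) • η ∘ (M_f y)^{⊗k}`. [folklore] -/
theorem testForm_inChart (f : M → ℝ) (η : E [⋀^Fin k]→L[ℝ] ℂ) {y : E} (hy : y ∈ (e₀).target) :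
    MForm.inChart (Θ[f, η]) x₀ y = f ((e₀).symm y) • η.compContinuousLinearMap (Mf[y]) := by
  have hMf : Mf[e₀ ((e₀).symm y)] = Mf[y] := by rw [(e₀).right_inv hy]
  ext v
  rw [MForm.inChart_apply]
  change f ((e₀).symm y) • η (fun i ↦ (ContinuousLinearMap.comp (Mf[e₀ ((e₀).symm y)])
      (mfderiv 𝓘(ℝ, E) 𝓘(ℝ, E) (e₀) ((e₀).symm y)))
      (mfderivWithin 𝓘(ℝ, E) 𝓘(ℝ, E) (e₀).symm (range 𝓘(ℝ, E)) y (v i))) =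
    f ((e₀).symm y) • η (fun i ↦ Mf[y] (v i))
  have h1 : ∀ w, (ContinuousLinearMap.comp (Mf[e₀ ((e₀).symm y)])
      (mfderiv 𝓘(ℝ, E) 𝓘(ℝ, E) (e₀) ((e₀).symm y)))
      (mfderivWithin 𝓘(ℝ, E) 𝓘(ℝ, E) (e₀).symm (range 𝓘(ℝ, E)) y w) = Mf[y] w := fun w ↦
    (congrArg (Mf[e₀ ((e₀).symm y)]) (chartDeriv_apply_symmDeriv x₀ hy w)).trans
      (congrArg (fun T : E →L[ℝ] E ↦ T w) hMf)
  simp only [h1]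

/-! #### Smoothness -/

variable [FiniteDimensional ℝ E]

/-- **The test forms are smooth.** If `f` is a smooth bump function centred at `x₀` on whose closed
support the frame `M_f` is `C^∞` in the chart (`hMf`; cf. `eventually_contDiffAt_frameM`), then
`Θ_{f,η}` is a smooth form on `M`: near points of the support its chart representative is
`y ↦ f(e⁻¹ y) • η ∘ (M_f y)^{⊗k}` (`testForm_inChart`), and it vanishes near the other points.
[cite: Voisin2002, §6.1.1 Prop. 6.5] -/
theorem isSmoothForm_testForm [T2Space M] (f : SmoothBumpFunction 𝓘(ℝ, E) x₀)
    (η : E [⋀^Fin k]→L[ℝ] ℂ) (hMf : ∀ z ∈ tsupport f, ContDiffAt ℝ ∞ (fun y ↦ Mf[y]) (e₀ z)) :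
    IsSmoothForm (Θ[f, η]) := by
  rw [isSmoothForm_iff_smoothAt]
  intro z
  by_cases hz : z ∈ tsupport f
  · have hzs : z ∈ (e₀).source := by
      rw [extChartAt_source]
      exact f.tsupport_subset_chartAt_source hz
    rw [MForm.smoothAt_iff_contDiffWithinAt_inChart hzs]
    have hev : MForm.inChart (Θ[f, η]) x₀ =ᶠ[𝓝 (e₀ z)]
        fun y ↦ f ((e₀).symm y) • η.compContinuousLinearMap (Mf[y]) := by
      filter_upwards [(isOpen_extChartAt_target (I := 𝓘(ℝ, E)) x₀).mem_nhds ((e₀).map_source hzs)]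
        with y hy
      exact testForm_inChart G S B x₀ f η hy
    have hf : ContDiffAt ℝ ∞ (fun y ↦ f ((e₀).symm y)) (e₀ z) := by
      have h1 : ContMDiffWithinAt 𝓘(ℝ, E) 𝓘(ℝ, ℝ) ∞ (f ∘ (e₀).symm) (range 𝓘(ℝ, E)) (e₀ z) := by
        have hfz : ContMDiffAt 𝓘(ℝ, E) 𝓘(ℝ, ℝ) ∞ f ((e₀).symm (e₀ z)) := f.contMDiffAt
        exact hfz.comp_contMDiffWithinAt _
          (contMDiffWithinAt_extChartAt_symm_range x₀ ((e₀).map_source hzs))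
      have h2 := contMDiffWithinAt_iff_contDiffWithinAt.1 h1
      rw [ModelWithCorners.Boundaryless.range_eq_univ, contDiffWithinAt_univ] at h2
      exact h2
    have hsm : ContDiffAt ℝ ∞ (fun y ↦ f ((e₀).symm y) • η.compContinuousLinearMap (Mf[y])) (e₀ z) :=
      hf.smul (ContDiffAt.continuousAlternatingMapCompContinuousLinearMap contDiffAt_const (hMf z hz))
    exact (hsm.congr_of_eventuallyEq hev).contDiffWithinAt
  · have h0 : ∀ᶠ w in 𝓝 z, (0 : MForm 𝓘(ℝ, E) M ℂ k) w = (Θ[f, η]) w := by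
      have hf : (f : M → ℝ) =ᶠ[𝓝 z] 0 := notMem_tsupport_iff_eventuallyEq.1 hz
      filter_upwards [hf] with w hw
      change (0 : TangentSpace 𝓘(ℝ, E) w [⋀^Fin k]→L[ℝ] ℂ) = f w • _
      rw [hw, Pi.zero_apply]
      exact (zero_smul ℝ (_ : TangentSpace 𝓘(ℝ, E) w [⋀^Fin k]→L[ℝ] ℂ)).symm
    exact (MForm.smoothAt_zero z).congr_of_eventuallyEq h0

/-! #### Type components -/

omit [CompleteSpace E] [FiniteDimensional ℝ E] in
/-- Real scalars commute with the type projections. [folklore] -/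
theorem typeProjAt_real_smul (p q : ℕ) (r : ℝ) (η : E [⋀^Fin k]→L[ℝ] ℂ) :
    typeProjAt p q (r • η) = r • typeProjAt p q η := by
  have h1 : ∀ (j : ℕ) (ξ : E [⋀^Fin j]→L[ℝ] ℂ), r • ξ = (r : ℂ) • ξ := fun j ξ ↦ by
    ext v
    simp only [ContinuousAlternatingMap.smul_apply, Complex.real_smul, smul_eq_mul]
  rw [h1, typeProjAt_smul, ← h1]

omit [FiniteDimensional ℝ E] in
/-- **Type components of the test forms**: at a point `y'` of the chart source where the frame
`M_f (e y')` is `ℂ`-linear (`hM`; `eventually_frameM_comm`), the `(p,q)`-component of `Θ_{f,η}`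
is the test form of the `(p,q)`-component of `η` (pull-back by a `ℂ`-linear map preserves types,
`typeProjAt_compContinuousLinearMap`). [cite: Voisin2002, §6.1.1 Prop. 6.5] -/
theorem testForm_typeComponent [IsManifold 𝓘(ℂ, E) ω M] (f : M → ℝ) (η : E [⋀^Fin k]→L[ℝ] ℂ)
    (p q : ℕ) {y' : M} (hy' : y' ∈ (e₀).source)
    (hM : Mf[e₀ y'] * ((Complex.I • ContinuousLinearMap.id ℂ E).restrictScalars ℝ) =
      ((Complex.I • ContinuousLinearMap.id ℂ E).restrictScalars ℝ) * Mf[e₀ y']) :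
    MForm.typeComponent p q (Θ[f, η]) y' = (Θ[f, typeProjAt p q η]) y' := by
  set Uc : E →L[ℝ] E := U[y'] with hUc
  -- `ℂ`-linearity of `U = M_f (e y') ∘ De_{y'}` from that of both factors
  have hI : ∀ w : E, Uc (Complex.I • w) = Complex.I • Uc w := fun w ↦
    (congrArg (Mf[e₀ y']) (chartDeriv_I_smul x₀ hy' w)).trans
      (congrArg (fun T : E →L[ℝ] E ↦ T (mfderiv 𝓘(ℝ, E) 𝓘(ℝ, E) (e₀) y' w)) hM)
  have hU : ∀ (c : ℂ) (w : E), Uc (c • w) = c • Uc w := by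
    intro c w
    have hc : ∀ z : E, c • z = (c.re : ℝ) • z + (c.im : ℝ) • (Complex.I • z) := fun z ↦ by
      conv_lhs => rw [← Complex.re_add_im c]
      rw [add_smul, ← Complex.coe_smul, mul_smul, ← Complex.coe_smul]
    rw [hc w, map_add, map_smul, map_smul, hI, hc (Uc w)]
  rw [typeComponent_apply_eq_typeProjAt]
  change typeProjAt p q (f y' • η.compContinuousLinearMap Uc) =
    f y' • (typeProjAt p q η).compContinuousLinearMap Uc
  rw [typeProjAt_real_smul, typeProjAt_compContinuousLinearMap p q η Uc hU]

/-! #### `dΘ(x₀) = 0` -/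

omit [FiniteDimensional ℝ E] in
/-- **The exterior derivative of a test form vanishes at the centre.** If `f = 1` near `x₀`, the
frame `M_f` is differentiable at `c` with derivative the Koszul map `B` (`hasFDerivAt_frameM`) and
`B` is symmetric (`koszul_symm'`), then `dΘ_{f,η}(x₀) = 0`: in the chart, `Θ` is `y ↦ η ∘ (M_f y)^{⊗k}`
near `c`, whose exterior derivative at `c` is the alternatization of
`(u, v, …) ↦ η(…, B u v, …)`, zero by symmetry of `B`
(`alternatizeUncurryFin_fderivCompContinuousLinearMap_eq_zero`). This is the point of the
osculating frame (Voisin (2002), Prop. 3.14 ⇒ proof of Prop. 6.5: "the coefficients have vanishing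
first derivatives at the point"). [cite: Voisin2002, Prop. 3.14, §6.1.1 Prop. 6.5] -/
theorem mextDeriv_testForm_eq_zero (f : M → ℝ) (hf : ∀ᶠ y' in 𝓝 x₀, f y' = 1)
    (η : E [⋀^Fin k]→L[ℝ] ℂ) (hB : ∀ u v, B u v = B v u)
    (hMd : HasFDerivAt (fun y ↦ Mf[y]) B c₀) : mextDeriv (Θ[f, η]) x₀ = 0 := by
  rw [mextDeriv_eq_extDerivWithin]
  show extDerivWithin (MForm.inChart (Θ[f, η]) x₀) (range 𝓘(ℝ, E)) c₀ =
    (0 : E [⋀^Fin (k + 1)]→L[ℝ] ℂ)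
  -- the representative agrees with `y ↦ η ∘ (M_f y)^{⊗k}` near `c`
  have hev : MForm.inChart (Θ[f, η]) x₀ =ᶠ[𝓝 c₀] fun y ↦ η.compContinuousLinearMap (Mf[y]) := by
    have hf' : ∀ᶠ y in 𝓝 c₀, f ((e₀).symm y) = 1 := by
      have hc : ContinuousAt (e₀).symm c₀ := continuousAt_extChartAt_symm x₀
      have : ∀ᶠ y' in 𝓝 ((e₀).symm c₀), f y' = 1 := by rwa [extChartAt_to_inv]
      exact hc.eventually this
    filter_upwards [hf', (isOpen_extChartAt_target (I := 𝓘(ℝ, E)) x₀).mem_nhds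
      (mem_extChartAt_target x₀)] with y hy1 hy
    rw [testForm_inChart G S B x₀ f η hy, hy1, one_smul]
  rw [(hev.filter_mono nhdsWithin_le_nhds).extDerivWithin_eq hev.self_of_nhds,
    ModelWithCorners.Boundaryless.range_eq_univ, extDerivWithin_univ, extDeriv]
  rw [fderiv_continuousAlternatingMapCompContinuousLinearMap (differentiableAt_const η)
    hMd.differentiableAt, fderiv_const_apply, ContinuousLinearMap.comp_zero, zero_add, hMd.fderiv]
  exact alternatizeUncurryFin_fderivCompContinuousLinearMap_eq_zero η _ hB

end TestForms

end Literature.Geometry.Kaehler
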